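import Summits.Ventures.HodgeKum4.FixedLocus
import Summits.Ventures.HodgeKum4.Theorems.KummerFixedLocusOrbitSpan
import Literature.AlgebraicGeometry.HodgeTheory.IsoTransport
import Literature.AlgebraicGeometry.HodgeTheory.VanishingCohomologyNontrivialProofs
import HarnessLib

/-!
# L3 of the `Kum⁴` blueprint follows from its two inputs (KERNEL step; cell `hodge-kum4`, seat p2)

HONEST FRAMING.  No case of the Hodge conjecture is asserted.  This file PROVES, with no named fact,

  `Kum4TranslationGroup → Kum4FixedFourfoldClasses → Kum4NonInvariantClassesAlgebraic`

(the cell's `Summits/Ventures/HodgeKum4/Statement.lean` for the three `Prop`s): for `X` smooth projective of `Kum⁴`-type, if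
`|Γ(X)| = 625`, the `Γ(X)`-non-invariant part `𝒦 ⊂ H⁸(X(ℂ); ℂ)` has dimension `≤ 624`, and there is an
algebraic class `w` (so with algebraic translates `ρ(g)w`) and a functional `φ` with `φ(ρ(g)w) = 1` (`g ≠ 1`),
`φ(w) ≠ 1` — then `𝒦 ⊆ span{ρ(g)w} ⊆ algebraicClasses X 4`, by the orbit-span lemma
(`OrbitSpan.coinvariantsKer_le_span_orbit`) and because `algebraicClasses X 4` is a `ℂ`-subspace.
Also the consumer form for the glue `L2 + L3 ⇒ HC(X)`: every class `c ∈ H⁸` differs from its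
`Γ`-average (a `Γ`-INVARIANT class) by an algebraic class (`sub_averageMap_mem_algebraicClasses_of`).
-/

noncomputable section

open CategoryTheory
open Literature.AlgebraicGeometry Literature.AlgebraicGeometry.HodgeTheory
  Literature.AlgebraicGeometry.Hyperkaehler

namespace Summit.Ventures.HodgeKum4

/-- Under `Kum4TranslationGroup`, `Γ(X)` is finite (of order `625`). -/
theorem finite_autFixingH2H3_of (hΓ : Kum4TranslationGroup) {X : Motives.SchemeOver ℂ}
    (hX : Motives.IsSmoothProjective 8 X) (hK : IsOfGeneralizedKummerType 4 X) :
    Finite (autFixingH2H3 X) :=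
  Nat.finite_of_card_ne_zero (by rw [(hΓ hX hK).1]; norm_num)

/-- **Translates of algebraic classes are algebraic**: `ρ(g) w = (g⁻¹)^* w` lies in
`algebraicClasses X 4` if `w` does — pull-back along an automorphism preserves the support
filtration (the tree's `HodgeTheory.mem_algebraicClasses_map_iff_of_iso`, Grothendieck 1969 §1). -/
theorem middleRep_mem_algebraicClasses {X : Motives.SchemeOver ℂ} {w : complexBetti X 8}
    (hw : w ∈ algebraicClasses X 4) (g : autFixingH2H3 X) :
    middleRep X g w ∈ algebraicClasses X 4 :=
  (mem_algebraicClasses_map_iff_of_iso (p := 4) ((g⁻¹ : autFixingH2H3 X).val) (c := w)).2 hw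

/-- **The span of the translates `ρ(g) w` of an algebraic class is algebraic**
(`algebraicClasses X 4` is a `ℂ`-subspace of `H⁸(X(ℂ); ℂ)` stable under automorphisms). -/
theorem span_orbit_le_algebraicClasses {X : Motives.SchemeOver ℂ} {w : complexBetti X 8}
    (halg : w ∈ algebraicClasses X 4) :
    Submodule.span ℂ (Set.range fun g : autFixingH2H3 X => middleRep X g w) ≤
      algebraicClasses X 4 := by
  rw [Submodule.span_le]
  rintro _ ⟨g, rfl⟩
  exact middleRep_mem_algebraicClasses halg g

/-- **KERNEL STEP `F_Γ ⇒ I ⇒ L3`.**  For `X` smooth projective of `Kum⁴`-type: `|Γ(X)| = 625`,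
`dim 𝒦 ≤ 624`, and an algebraic class `w` with Gram functional `φ`
(`φ(ρ(g)w) = 1` for `g ≠ 1`, `φ(w) ≠ 1`) give `𝒦 ⊆ span{ρ(g)w} ⊆ algebraicClasses X 4`
(orbit-span lemma `OrbitSpan.coinvariantsKer_le_span_orbit`; `H⁸(X(ℂ); ℂ)` is finite-dimensional
for smooth projective `X`, `finite_complexBetti`). -/
theorem kum4NonInvariantClassesAlgebraic_of (hΓ : Kum4TranslationGroup)
    (hW : Kum4FixedFourfoldClasses) : Kum4NonInvariantClassesAlgebraic := by
  intro X hX hK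
  obtain ⟨hcard, hdim⟩ := hΓ hX hK
  obtain ⟨w, φ, halg, hφ, hw⟩ := hW hX hK
  haveI : Finite (autFixingH2H3 X) := finite_autFixingH2H3_of hΓ hX hK
  letI : Fintype (autFixingH2H3 X) := Fintype.ofFinite _
  haveI : Module.Finite ℂ (complexBetti X 8) := finite_complexBetti hX 8
  have hcard' : Fintype.card (autFixingH2H3 X) = 625 := by
    rw [← Nat.card_eq_fintype_card]; exact hcard
  exact (OrbitSpan.coinvariantsKer_le_span_orbit (middleRep X) w φ 1 hφ hw (by omega)).trans
    (span_orbit_le_algebraicClasses halg)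

/-- **Consumer form for the glue.**  Under the same two inputs, for `X` smooth projective of
`Kum⁴`-type and ANY class `c ∈ H⁸(X(ℂ); ℂ)`: `c` minus its `Γ(X)`-average
`|Γ|⁻¹ Σ_g ρ(g) c` (Mathlib's `Representation.averageMap`, a `Γ(X)`-INVARIANT class,
`Representation.averageMap_invariant`) is an algebraic class of codimension `4`.  (With L2 — every
`Γ`-invariant rational Hodge class is algebraic — this gives the Hodge conjecture in degree `8`.)
The `Fintype`/`Invertible` instances are supplied by the consumer (`Fintype.ofFinite`,
`invertibleOfNonzero`; `|Γ| = 625 ≠ 0` in `ℂ`). -/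
theorem sub_averageMap_mem_algebraicClasses_of (hΓ : Kum4TranslationGroup)
    (hW : Kum4FixedFourfoldClasses) {X : Motives.SchemeOver ℂ}
    (hX : Motives.IsSmoothProjective 8 X) (hK : IsOfGeneralizedKummerType 4 X)
    [Fintype (autFixingH2H3 X)] [Invertible (Fintype.card (autFixingH2H3 X) : ℂ)]
    (c : complexBetti X 8) :
    c - (middleRep X).averageMap c ∈ algebraicClasses X 4 := by
  obtain ⟨hcard, hdim⟩ := hΓ hX hK
  obtain ⟨w, φ, halg, hφ, hw⟩ := hW hX hK
  haveI : Module.Finite ℂ (complexBetti X 8) := finite_complexBetti hX 8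
  have hcard' : Fintype.card (autFixingH2H3 X) = 625 := by
    rw [← Nat.card_eq_fintype_card]; exact hcard
  exact (OrbitSpan.coinvariantsKer_le_span_orbit (middleRep X) w φ 1 hφ hw (by omega)).trans
    (span_orbit_le_algebraicClasses halg) (OrbitSpan.sub_averageMap_mem_coinvariantsKer _ c)

/-- **All or nothing, for the record**: under the two inputs the non-invariant part has dimension
EXACTLY `624` (each non-trivial character of `Γ ≅ (ℤ/5)⁴` occurs once in `H⁸`), by
`OrbitSpan.finrank_coinvariantsKer_add_one`. -/
theorem finrank_nonInvariant_eq_of (hΓ : Kum4TranslationGroup) (hW : Kum4FixedFourfoldClasses)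
    {X : Motives.SchemeOver ℂ} (hX : Motives.IsSmoothProjective 8 X)
    (hK : IsOfGeneralizedKummerType 4 X) :
    Module.finrank ℂ (Representation.Coinvariants.ker (middleRep X)) = 624 := by
  obtain ⟨hcard, hdim⟩ := hΓ hX hK
  obtain ⟨w, φ, -, hφ, hw⟩ := hW hX hK
  haveI : Finite (autFixingH2H3 X) := finite_autFixingH2H3_of hΓ hX hK
  letI : Fintype (autFixingH2H3 X) := Fintype.ofFinite _
  haveI : Module.Finite ℂ (complexBetti X 8) := finite_complexBetti hX 8
  have hcard' : Fintype.card (autFixingH2H3 X) = 625 := by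
    rw [← Nat.card_eq_fintype_card]; exact hcard
  have h := OrbitSpan.finrank_coinvariantsKer_add_one (middleRep X) w φ 1 hφ hw (by omega)
  omega

end Summit.Ventures.HodgeKum4

end
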